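import Literature.Analysis.FluidPDE.TorusClassicalNSL2H4Smoothing
import HarnessLib

/-!
# A time of controlled `H⁴` Sobolev sums for classical Navier–Stokes solutions on `T³`

Analysis/FluidPDE proof file (theorems only; no definitions, no named facts), sequel of
`TorusClassicalNSL2H4Smoothing.lean` (the time-integrated bound `∫ₐ^{a+τ} ‖Δ²u‖₂² ≤ C₄` for classical
solutions of the forced Navier–Stokes system on `T^d × [a, a + τ]`, `card d = 3`, under sup bounds of
`‖∇u‖₂²`, `‖Δu‖₂²`, `‖∇Δu‖₂²`, `‖Δf‖₂²`). Two elementary steps turn that bound into the form consumed by a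
continuation argument which restarts a local existence theorem stated with FOURTH SOBOLEV SUMS of the datum
(`Torus.exists_classicalNS_smooth_of_sobolevBound`: `∑_{k∈S} (1+|k|²)⁴ ‖û₀(k)‖² ≤ M` for all finite `S`):

* **Chebyshev / integral mean value in time**
  (`Torus.IsClassicalNSSolutionOn.exists_mem_Icc_integral_norm_laplacian_laplacian_sq_le_of_le`): the continuous
  function `W(s) = ‖Δ²u(s)‖₂²` attains its minimum on the compact interval `[a, a + τ]` at some `t₁`, and
  `τ W(t₁) ≤ ∫ₐ^{a+τ} W ≤ C₄`, so `‖Δ²u(t₁)‖₂² ≤ C₄ / τ`;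
* **the Fourier dictionary at the time `t₁`** (`Torus.sum_one_add_freqNormSq_pow_four_mul_sq_norm_mFourierCoeff_le`):
  for a smooth MEAN-ZERO field `v` on `T^d` and every finite `S ⊆ ℤ^d`,
  `∑_{k∈S} (1+|k|²)⁴ ‖v̂(k)‖² ≤ ‖Δ²v‖₂²` — the zero mode vanishes, `1 + |k|² ≤ 4π²|k|²` for `k ≠ 0`
  (`|k|² ≥ 1` on the punctured lattice and `4π² ≥ 2`), the Laplacian has symbol `-4π²|k|²`
  (`Torus.mFourierCoeff_complexify_laplacian`, twice), and the partial sums of Parseval's series of the smooth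
  field `Δ²v` are bounded by `∫ ‖Δ²v‖²` (`Torus.hasSum_sq_norm_mFourierCoeff_complexify`, `sum_le_hasSum`).

The main theorem `Torus.IsClassicalNSSolutionOn.exists_mem_Icc_sobolevFourSum_le_of_le` combines the two:
under the hypotheses of the `L²_t H⁴` bound there is a time `t₁ ∈ [a, a + τ]` at which all fourth Sobolev
sums of `u(t₁)` are `≤ C(d, ν, E₁, Y₁, Z₁, G₂, τ)`, uniformly in `a` and in the solution (Robinson–Rodrigo–Sadowski
2016, Thm 7.1: the bound `u ∈ L²(0, T; H^{k+1})` of the regularity induction, `k = 3`, read at a good time).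
Deliberately NOT here: pointwise-in-time `H⁴` bounds, the restart itself, anything about existence.

## Mathlib / tree search

Tree (reused): `Torus.IsClassicalNSSolutionOn.intervalIntegral_norm_laplacian_laplacian_sq_le_of_le`
(`TorusClassicalNSL2H4Smoothing`), `Torus.IsSmoothSpaceTimeOn.laplacian/inner/continuousOn_integral`
(`TorusSpaceTime`), `Torus.mFourierCoeff_complexify_laplacian` (`TorusFourierModes`),
`Torus.hasSum_sq_norm_mFourierCoeff_complexify` (`TorusVectorParseval`), `Torus.one_le_freqNormSq_of_ne_zero`
(`TorusInverseLaplacian`), `Torus.mFourierCoeff_eq_integral_volume` (`TorusFourierCalculus`); the zero-mode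
computation is the three-line argument of `Torus.mFourierCoeff_complexify_eq_zero_of_hasZeroMean`
(`TorusTruncationH1`, not imported: it pulls in the Duchon–Robert files). Mathlib: `IsCompact.exists_isMinOn`,
`intervalIntegral.integral_mono_on`, `sum_le_hasSum`. Searched `(1 + freqNormSq k) ^ 4` (only hypotheses of the
local existence theorems and Galerkin bookkeeping), `exists.*integral_norm_laplacian_laplacian`, `sobolevFourSum`:
no time-of-controlled-`H⁴`-norm statement in the tree.

## References

* J. C. Robinson, J. L. Rodrigo, W. Sadowski, *The Three-Dimensional Navier–Stokes Equations*,
  CUP 2016, Thm 7.1 ((7.3)), §1.5 (Sobolev norms on the torus via Fourier series). [RobinsonRodrigoSadowskiCUP2016]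
* L. Grafakos, *Classical Fourier Analysis*, 3rd ed., GTM 249 (2014), Prop. 3.2.6 (8), Prop. 3.2.7 (3). [Grafakos2014]
-/

noncomputable section

open MeasureTheory Set Function Filter UnitAddTorus
open scoped ContDiff InnerProductSpace RealInnerProductSpace Topology NNReal

namespace Literature.Analysis.FluidPDE

open Literature.Analysis.FunctionSpaces

variable {d : Type*} [Fintype d] [DecidableEq d]

/-! ### The Fourier dictionary: fourth Sobolev sums of a mean-zero field against `‖Δ²v‖₂²` -/

/-- **Fourier coefficients of the bi-Laplacian**: `‖𝓕(complexify ∘ Δ²v)(k)‖ = (4π²|k|²)² ‖v̂(k)‖` for smooth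
`v : T^d → ℝ^d` (the symbol `-4π²|k|²` of `Δ`, Grafakos 2014, Prop. 3.2.6 (8), applied twice).
[cite: Grafakos2014, Prop. 3.2.6] -/
theorem Torus.norm_mFourierCoeff_complexify_laplacian_laplacian {v : UnitAddTorus d → EuclideanSpace ℝ d}
    (hv : Torus.IsSmooth v) (k : d → ℤ) :
    ‖mFourierCoeff (EuclideanSpace.complexify ∘ Torus.laplacian (Torus.laplacian v)) k‖ =
      (4 * Real.pi ^ 2 * Torus.freqNormSq k) ^ 2 * ‖mFourierCoeff (EuclideanSpace.complexify ∘ v) k‖ := by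
  have hr : 0 ≤ 4 * Real.pi ^ 2 * Torus.freqNormSq k := by
    have := Torus.freqNormSq_nonneg k
    positivity
  rw [Torus.mFourierCoeff_complexify_laplacian hv.laplacian k, Torus.mFourierCoeff_complexify_laplacian hv k,
    smul_neg, neg_neg, smul_smul, norm_smul, ← Complex.ofReal_mul, Complex.norm_of_nonneg (mul_nonneg hr hr)]
  ring

omit [DecidableEq d] in
/-- On the punctured lattice the inhomogeneous weight is dominated by the Laplacian symbol:
`1 + |k|² ≤ 4π²|k|²` for `k ≠ 0` (`|k|² ≥ 1` and `4π² ≥ 2`). [folklore] -/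
theorem Torus.one_add_freqNormSq_le_laplacian_symbol {k : d → ℤ} (hk : k ≠ 0) :
    1 + Torus.freqNormSq k ≤ 4 * Real.pi ^ 2 * Torus.freqNormSq k := by
  have h1 : 1 ≤ Torus.freqNormSq k := Torus.one_le_freqNormSq_of_ne_zero hk
  have h0 : 0 ≤ Torus.freqNormSq k := Torus.freqNormSq_nonneg k
  have hπ : (2 : ℝ) ≤ 4 * Real.pi ^ 2 := by nlinarith [Real.two_le_pi, Real.pi_pos]
  calc 1 + Torus.freqNormSq k ≤ Torus.freqNormSq k + Torus.freqNormSq k := by linarith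
    _ = 2 * Torus.freqNormSq k := by ring
    _ ≤ 4 * Real.pi ^ 2 * Torus.freqNormSq k := mul_le_mul_of_nonneg_right hπ h0

/-- **Modewise `H⁴` bound for mean-zero fields**: for smooth `v : T^d → ℝ^d` with `∫ v = 0` and every
`k ∈ ℤ^d`, `(1 + |k|²)⁴ ‖v̂(k)‖² ≤ ‖𝓕(complexify ∘ Δ²v)(k)‖²` — at `k = 0` the left side vanishes
(`v̂(0) = complexify (∫ v) = 0`), at `k ≠ 0` use `1 + |k|² ≤ 4π²|k|²` and the bi-Laplacian symbol. [folklore] -/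
theorem Torus.one_add_freqNormSq_pow_four_mul_sq_norm_mFourierCoeff_le {v : UnitAddTorus d → EuclideanSpace ℝ d}
    (hv : Torus.IsSmooth v) (h0 : Torus.HasZeroMean v) (k : d → ℤ) :
    (1 + Torus.freqNormSq k) ^ 4 * ‖mFourierCoeff (EuclideanSpace.complexify ∘ v) k‖ ^ 2 ≤
      ‖mFourierCoeff (EuclideanSpace.complexify ∘ Torus.laplacian (Torus.laplacian v)) k‖ ^ 2 := by
  by_cases hk : k = 0
  · subst hk
    -- adapted from `Torus.mFourierCoeff_complexify_eq_zero_of_hasZeroMean` (`TorusTruncationH1`)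
    have hzero : mFourierCoeff (EuclideanSpace.complexify ∘ v) 0 = 0 := by
      rw [Torus.mFourierCoeff_eq_integral_volume]
      simp only [neg_zero, mFourier_zero, ContinuousMap.one_apply, one_smul, Function.comp_apply]
      rw [EuclideanSpace.complexify.integral_comp_comm v, h0, map_zero]
    rw [hzero, norm_zero, zero_pow two_ne_zero, mul_zero]
    exact sq_nonneg _
  · rw [Torus.norm_mFourierCoeff_complexify_laplacian_laplacian hv k, mul_pow, ← pow_mul]
    exact mul_le_mul_of_nonneg_right
      (pow_le_pow_left₀ (by have := Torus.freqNormSq_nonneg k; positivity)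
        (Torus.one_add_freqNormSq_le_laplacian_symbol hk) 4) (sq_nonneg _)

/-- **Fourth Sobolev sums of a mean-zero field are bounded by `‖Δ²v‖₂²`**: for smooth `v : T^d → ℝ^d`
with `∫ v = 0` and every finite `S ⊆ ℤ^d`, `∑_{k∈S} (1 + |k|²)⁴ ‖v̂(k)‖² ≤ ∫ ‖Δ²v‖²` (modewise bound, then
the partial sums of the Parseval series of the smooth field `Δ²v`, Grafakos 2014, Prop. 3.2.7 (3), are
bounded by its sum). This is the hypothesis shape of `Torus.exists_classicalNS_smooth_of_sobolevBound`.
[cite: Grafakos2014, Prop. 3.2.7 (3)] -/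
theorem Torus.sum_one_add_freqNormSq_pow_four_mul_sq_norm_mFourierCoeff_le
    {v : UnitAddTorus d → EuclideanSpace ℝ d} (hv : Torus.IsSmooth v) (h0 : Torus.HasZeroMean v)
    (S : Finset (d → ℤ)) :
    ∑ k ∈ S, (1 + Torus.freqNormSq k) ^ 4 * ‖mFourierCoeff (EuclideanSpace.complexify ∘ v) k‖ ^ 2 ≤
      ∫ x, ‖Torus.laplacian (Torus.laplacian v) x‖ ^ 2 := by
  have hP := Torus.hasSum_sq_norm_mFourierCoeff_complexify (hv.laplacian.laplacian.memLp 2)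
  calc ∑ k ∈ S, (1 + Torus.freqNormSq k) ^ 4 * ‖mFourierCoeff (EuclideanSpace.complexify ∘ v) k‖ ^ 2
      ≤ ∑ k ∈ S, ‖mFourierCoeff (EuclideanSpace.complexify ∘ Torus.laplacian (Torus.laplacian v)) k‖ ^ 2 :=
        Finset.sum_le_sum fun k _ => Torus.one_add_freqNormSq_pow_four_mul_sq_norm_mFourierCoeff_le hv h0 k
    _ ≤ ∫ x, ‖Torus.laplacian (Torus.laplacian v) x‖ ^ 2 := sum_le_hasSum S (fun k _ => sq_nonneg _) hP

/-! ### A time of controlled `‖Δ²u‖₂²` (Chebyshev) -/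

/-- **A time of controlled `H⁴` seminorm** (Robinson–Rodrigo–Sadowski 2016, Thm 7.1, the
`L²(0, T; H^{k+1})` bound of the induction, `k = 3`, read at a good time): on `T^d` with `card d = 3`, for
`ν > 0`, levels `E₁, Y₁, Z₁, G₂` and a time lapse `τ > 0` there is a constant `C` such that every classical
solution `(u, p)` with force `f` on `[a, a + τ] × T^d` with zero-mean velocity slices, `‖∇u(t)‖₂² ≤ E₁`,
`∫ ‖Δu(t)‖² ≤ Y₁`, `‖∇Δu(t)‖₂² ≤ Z₁`, `∫ ‖Δf(t)‖² ≤ G₂` on `[a, a + τ]` admits a time `t₁ ∈ [a, a + τ]` with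
`∫ ‖Δ²u(t₁)‖² ≤ C` (`C = C₄ / τ`, `C₄` the time-integrated bound of
`intervalIntegral_norm_laplacian_laplacian_sq_le_of_le`). Proof: `W(s) = ∫ ‖Δ²u(s)‖²` is continuous on the
compact interval (joint smoothness of `Δ²u`), so it attains its minimum at some `t₁`, and
`τ W(t₁) = ∫ₐ^{a+τ} W(t₁) ≤ ∫ₐ^{a+τ} W ≤ C₄`. [cite: RobinsonRodrigoSadowskiCUP2016, Thm 7.1 (7.3)] -/
theorem _root_.Literature.Analysis.FunctionSpaces.Torus.IsClassicalNSSolutionOn.exists_mem_Icc_integral_norm_laplacian_laplacian_sq_le_of_le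
    (hd : Fintype.card d = 3) {ν : ℝ} (hν : 0 < ν) (E₁ Y₁ Z₁ G₂ : ℝ) {τ : ℝ} (hτ : 0 < τ) :
    ∃ C : ℝ, ∀ {a : ℝ} {f u : ℝ → UnitAddTorus d → EuclideanSpace ℝ d} {p : ℝ → UnitAddTorus d → ℝ},
      Torus.IsClassicalNSSolutionOn (Icc a (a + τ)) ν f u p →
      (∀ t ∈ Icc a (a + τ), Torus.HasZeroMean (u t)) →
      (∀ t ∈ Icc a (a + τ), Torus.gradNormSq (u t) ≤ E₁) →
      (∀ t ∈ Icc a (a + τ), ∫ x, ‖Torus.laplacian (u t) x‖ ^ 2 ≤ Y₁) →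
      (∀ t ∈ Icc a (a + τ), Torus.gradNormSq (Torus.laplacian (u t)) ≤ Z₁) →
      (∀ t ∈ Icc a (a + τ), ∫ x, ‖Torus.laplacian (f t) x‖ ^ 2 ≤ G₂) →
        ∃ t₁ ∈ Icc a (a + τ), ∫ x, ‖Torus.laplacian (Torus.laplacian (u t₁)) x‖ ^ 2 ≤ C := by
  obtain ⟨C₄, hC₄⟩ :=
    Torus.IsClassicalNSSolutionOn.intervalIntegral_norm_laplacian_laplacian_sq_le_of_le hd hν E₁ Y₁ Z₁ G₂ hτ
  refine ⟨C₄ / τ, fun {a f u p} h h0 hE hY hZ hG₂ => ?_⟩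
  have hint : ∫ s in a..(a + τ), (∫ x, ‖Torus.laplacian (Torus.laplacian (u s)) x‖ ^ 2) ≤ C₄ :=
    hC₄ h h0 hE hY hZ hG₂
  set b : ℝ := a + τ with hb
  have hab : a < b := by rw [hb]; linarith
  have hU : UniqueDiffOn ℝ (Icc a b) := uniqueDiffOn_Icc hab
  -- `W(s) = ∫ ‖Δ²u(s)‖²` is continuous on `[a, b]`
  set W : ℝ → ℝ := fun s => ∫ x, ‖Torus.laplacian (Torus.laplacian (u s)) x‖ ^ 2 with hWdef
  have hΔΔ : Torus.IsSmoothSpaceTimeOn (Icc a b) (fun t => Torus.laplacian (Torus.laplacian (u t))) :=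
    (h.smooth_velocity.laplacian hU).laplacian hU
  have hWc : ContinuousOn W (Icc a b) := by
    have h1 := (hΔΔ.inner hΔΔ).continuousOn_integral (convex_Icc a b)
    refine h1.congr fun s _ => ?_
    simp only [hWdef, real_inner_self_eq_norm_sq]
  -- its minimiser `t₁` on the compact interval is a Chebyshev time
  obtain ⟨t₁, ht₁, hmin⟩ := isCompact_Icc.exists_isMinOn (nonempty_Icc.2 hab.le) hWc
  refine ⟨t₁, ht₁, ?_⟩
  have hWi : IntervalIntegrable W volume a b := hWc.intervalIntegrable_of_Icc hab.le
  have h1 : τ * W t₁ ≤ ∫ s in a..b, W s := by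
    have h2 : ∫ _ in a..b, W t₁ = τ * W t₁ := by
      rw [intervalIntegral.integral_const, smul_eq_mul, hb, add_sub_cancel_left]
    rw [← h2]
    exact intervalIntegral.integral_mono_on hab.le intervalIntegrable_const hWi
      fun s hs => isMinOn_iff.1 hmin s hs
  change W t₁ ≤ C₄ / τ
  rw [le_div_iff₀ hτ, mul_comm]
  exact h1.trans hint

/-! ### The main theorem -/

/-- **A time of controlled fourth Sobolev sums for classical Navier–Stokes solutions on `T³`**
(Robinson–Rodrigo–Sadowski 2016, Thm 7.1, `k = 3`, at a Chebyshev time; the quantity through which a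
continuation argument restarts the local existence theorem `Torus.exists_classicalNS_smooth_of_sobolevBound`):
on `T^d` with `card d = 3`, for `ν > 0`, levels `E₁, Y₁, Z₁` (of `‖∇u‖₂²`, `‖Δu‖₂²`, `‖∇Δu‖₂²`), a force
level `G₂` (of `‖Δf‖₂²`) and a time lapse `τ > 0` there is a constant `C` such that EVERY classical solution
`(u, p)` of the Navier–Stokes system with force `f` on `[a, a + τ] × T^d` whose velocity slices have zero
mean, `‖∇u(t)‖₂² ≤ E₁`, `∫ ‖Δu(t)‖² ≤ Y₁`, `‖∇Δu(t)‖₂² ≤ Z₁` and `∫ ‖Δf(t)‖² ≤ G₂` for `t ∈ [a, a + τ]`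
admits a time `t₁ ∈ [a, a + τ]` at which `∑_{k∈S} (1 + |k|²)⁴ ‖û(t₁)(k)‖² ≤ C` for every finite
`S ⊆ ℤ^d` — uniformly in `a` and in the solution. Proof: the Chebyshev time of
`exists_mem_Icc_integral_norm_laplacian_laplacian_sq_le_of_le` and the Fourier dictionary
`Torus.sum_one_add_freqNormSq_pow_four_mul_sq_norm_mFourierCoeff_le` for the smooth mean-zero slice `u(t₁)`.
[cite: RobinsonRodrigoSadowskiCUP2016, Thm 7.1 (7.3)] -/
theorem _root_.Literature.Analysis.FunctionSpaces.Torus.IsClassicalNSSolutionOn.exists_mem_Icc_sobolevFourSum_le_of_le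
    (hd : Fintype.card d = 3) {ν : ℝ} (hν : 0 < ν) (E₁ Y₁ Z₁ G₂ : ℝ) {τ : ℝ} (hτ : 0 < τ) :
    ∃ C : ℝ, ∀ {a : ℝ} {f u : ℝ → UnitAddTorus d → EuclideanSpace ℝ d} {p : ℝ → UnitAddTorus d → ℝ},
      Torus.IsClassicalNSSolutionOn (Icc a (a + τ)) ν f u p →
      (∀ t ∈ Icc a (a + τ), Torus.HasZeroMean (u t)) →
      (∀ t ∈ Icc a (a + τ), Torus.gradNormSq (u t) ≤ E₁) →
      (∀ t ∈ Icc a (a + τ), ∫ x, ‖Torus.laplacian (u t) x‖ ^ 2 ≤ Y₁) →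
      (∀ t ∈ Icc a (a + τ), Torus.gradNormSq (Torus.laplacian (u t)) ≤ Z₁) →
      (∀ t ∈ Icc a (a + τ), ∫ x, ‖Torus.laplacian (f t) x‖ ^ 2 ≤ G₂) →
        ∃ t₁ ∈ Icc a (a + τ), ∀ S : Finset (d → ℤ),
          ∑ k ∈ S, (1 + Torus.freqNormSq k) ^ 4 *
            ‖mFourierCoeff (EuclideanSpace.complexify ∘ u t₁) k‖ ^ 2 ≤ C := by
  obtain ⟨C, hC⟩ :=
    Torus.IsClassicalNSSolutionOn.exists_mem_Icc_integral_norm_laplacian_laplacian_sq_le_of_le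
      hd hν E₁ Y₁ Z₁ G₂ hτ
  refine ⟨C, fun {a f u p} h h0 hE hY hZ hG₂ => ?_⟩
  obtain ⟨t₁, ht₁, hle⟩ := hC h h0 hE hY hZ hG₂
  exact ⟨t₁, ht₁, fun S =>
    (Torus.sum_one_add_freqNormSq_pow_four_mul_sq_norm_mFourierCoeff_le
      (h.smooth_velocity.isSmooth_slice ht₁) (h0 t₁ ht₁) S).trans hle⟩

end Literature.Analysis.FluidPDE

end
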